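import Summits.CriticalPhenomena.CardyFormulaZ2.Theorems.CardySusyWardWeakHolomorphyReduction

/-!
# The four-dart split at every spin, and the vertex form of the spin-`−5/3` alias

Line `Sketch` of the crux `CardySusyWard.WeakHolomorphy` (stmt-CriticalPhenomena-11292), lead c3 (infrastructure,
`--supports`).  The sibling line's FOUR-DART SPLIT (`fourDart_split_medialExploration`, spin `1/3`:
`2cos(π/12)·passageSum γ δ (1/3) z = Σ_{4 corners} dartPhaseSum γ δ (1/3) c`) holds at EVERY spin `σ` with the constant
`2cos(σπ/4)` (`split_phase_spin`: if `|b − a| = π/2` then `2cos(σπ/4) e^{-iσ(a+b)/2} = e^{-iσa} + e^{-iσb}`; the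
combinatorics of the passages is spin-free): `fourDart_split_spin`, `fourDart_split_medialExploration_spin`.  Integrated at
`σ = −5/3` (constant `2cos(5π/12) = 2 sin(π/12) > 0`) and combined with the corner-table dictionary `sum_classComp_pivotOf`:
eventually along an admissible family, above every compact,
  `2cos(5π/12) · F^{(−5/3)}_δ(z_p) = Σ_k bondDartObservable (Λ δ) δ (−5/3) (c_{p,k})`,
`F^{(−5/3)}_δ(z) = ∫ passageSum (medialExploration (Λ δ) ω) δ (−5/3) z dP_{1/2}` the bisector-convention VERTEX observable of
the exploration path at the alias spin (`aliasVertex_eq_sum_eventually`).  Used by `…WeakHolomorphyAliasCrux.lean` to state the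
crux as its own formula at the alias spin.  References: S. Smirnov, Ann. Math. 172 (2010) §2.2; Duminil-Copin–Smirnov
arXiv:1109.1549 §8.3.1.
-/

noncomputable section

namespace Summit.CriticalPhenomena.CardyFormulaZ2.Theorems.WeakHolomorphy.SplitBypass

open scoped BigOperators Topology
open Filter Set MeasureTheory
open _root_.Literature.Probability.LatticeModels
open _root_.Literature.Probability.RandomPlanarGeometry (DobrushinDomain)
open _root_.Literature.Probability.Percolation (BondConfig bondPercolation half)
open _root_.Literature.Barriers.CriticalPhenomena (medialCornersAt medialVertexOf)
open Summit.CriticalPhenomena.CardyFormulaZ2.Theorems.ParafermionPrecompact.Negative (IsFamily)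
open Summit.CriticalPhenomena.CardyFormulaZ2.Cruxes.ParafermionPrecompact.KenyonStreamSecondRelation
  (mv ex pivotOf classOffset classComp corners_at_mv corner_of_target_eq_mv corner_of_source_eq_mv
    abs_turning_at_mv winding_take_succ sum_passages_in sum_passages_out sum_classes_eq infix_pair_getElem'
    integrable_dartPhaseSum)

/-- Local table (as in `…FourDartSplit`): class of the dart leaving `s(x, x + eᵢ)` from the pivot `x`. -/
local notation "outL" => (![0, 1] : Fin 2 → Fin 4)
/-- Local table: class of the dart leaving `s(x, x + eᵢ)` from the pivot `x + eᵢ`. -/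
local notation "outR" => (![2, 3] : Fin 2 → Fin 4)
/-- Local table: class of the dart arriving at `s(x, x + eᵢ)` with pivot `x`. -/
local notation "inL" => (![3, 0] : Fin 2 → Fin 4)
/-- Local table: class of the dart arriving at `s(x, x + eᵢ)` with pivot `x + eᵢ`. -/
local notation "inR" => (![1, 2] : Fin 2 → Fin 4)

/-! ## The phase identity at a passage, every spin -/

/-- **Vertex phase versus dart phases, spin `σ`**: if `|b − a| = π/2` then
`2 cos(σπ/4) · e^{-iσ(a+b)/2} = e^{-iσ a} + e^{-iσ b}`. [folklore] -/
theorem split_phase_spin (σ : ℝ) {a b : ℝ} (h : |b - a| = Real.pi / 2) :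
    ((2 * Real.cos (σ * Real.pi / 4) : ℝ) : ℂ) *
        Complex.exp (-Complex.I * (σ : ℂ) * (((a + b) / 2 : ℝ) : ℂ)) =
      Complex.exp (-Complex.I * (σ : ℂ) * (a : ℂ)) + Complex.exp (-Complex.I * (σ : ℂ) * (b : ℂ)) := by
  obtain ⟨t, rfl⟩ : ∃ t, b = a + t := ⟨b - a, by ring⟩
  rw [add_sub_cancel_left] at h
  have ht : Real.cos (σ * Real.pi / 4) = Real.cos (σ * t / 2) := by
    rw [← Real.cos_abs (σ * t / 2), show |σ * t / 2| = |σ| * (Real.pi / 4) by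
      rw [abs_div, abs_mul, h, abs_of_pos (by norm_num : (0:ℝ) < 2)]; ring,
      ← Real.cos_abs (σ * Real.pi / 4), show |σ * Real.pi / 4| = |σ| * (Real.pi / 4) by
      rw [abs_div, abs_mul, abs_of_pos Real.pi_pos, abs_of_pos (by norm_num : (0:ℝ) < 4)]; ring]
  have key : (2 * Real.cos (σ * t / 2) : ℂ) * Complex.exp (-((σ * t / 2 : ℝ) : ℂ) * Complex.I) =
      1 + Complex.exp (-(2 * ((σ * t / 2 : ℝ) : ℂ)) * Complex.I) := by
    rw [Complex.ofReal_cos, Complex.two_cos, add_mul, ← Complex.exp_add, ← Complex.exp_add]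
    congr 1
    · rw [← Complex.exp_zero]; congr 1; ring
    · congr 1; ring
  have e1 : Complex.exp (-Complex.I * (σ : ℂ) * (((a + (a + t)) / 2 : ℝ) : ℂ)) =
      Complex.exp (-Complex.I * (σ : ℂ) * (a : ℂ)) * Complex.exp (-((σ * t / 2 : ℝ) : ℂ) * Complex.I) := by
    rw [← Complex.exp_add]; congr 1; push_cast; ring
  have e2 : Complex.exp (-Complex.I * (σ : ℂ) * ((a + t : ℝ) : ℂ)) =
      Complex.exp (-Complex.I * (σ : ℂ) * (a : ℂ)) * Complex.exp (-(2 * ((σ * t / 2 : ℝ) : ℂ)) * Complex.I) := by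
    rw [← Complex.exp_add]; congr 1; push_cast; ring
  rw [ht, e1, e2, ← mul_assoc, mul_comm (((2 * Real.cos (σ * t / 2) : ℝ) : ℂ)), mul_assoc]
  push_cast at key ⊢
  rw [key]; ring

/-! ## The four-dart split, every spin -/

/-- **FOUR-DART SPLIT (lists), spin `σ`.** If all darts of `γ` are medial and the genuine medial vertex `z = s(x, x + eᵢ)` is
neither the first nor the last vertex of `γ`, then `2 cos(σπ/4)` times the spin-`σ` passage sum of `γ` at `z` is the sum of its
spin-`σ` dart phase sums over the four class corners at `z`. [folklore] -/
theorem fourDart_split_spin (σ : ℝ) {γ : List MedialVertex} {δ : ℝ} (hδ : δ ≠ 0) (x : Site 2) (i : Fin 2)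
    (hdart : ∀ k (hk : k + 1 < γ.length), IsMedialDart (γ[k]'(by omega)) (γ[k + 1]'hk))
    (hhead : ∀ k (hk : k < γ.length), γ[k]'hk = mv (x, i) → k ≠ 0)
    (hlast : ∀ k (hk : k < γ.length), γ[k]'hk = mv (x, i) → k + 1 < γ.length) :
    ((2 * Real.cos (σ * Real.pi / 4) : ℝ) : ℂ) * MedialPath.passageSum γ δ σ (mv (x, i)) =
      ∑ q : Fin 4, Parafermion.dartPhaseSum γ δ σ (pivotOf x i q, pivotOf x i q + classOffset q) := by
  let e : ℕ → ℂ := fun m => Complex.exp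
    (-Complex.I * (σ : ℂ) * ((Polyline.winding ((γ.map (medialPoint δ)).take m) : ℝ) : ℂ))
  have hsplit : ∀ k ∈ (Finset.range γ.length).filter (fun k => γ[k]? = some (mv (x, i))),
      ((2 * Real.cos (σ * Real.pi / 4) : ℝ) : ℂ) *
          Complex.exp (-Complex.I * (σ : ℂ) * ((MedialPath.windingAt γ δ k : ℝ) : ℂ)) = e (k + 1) + e (k + 2) := by
    intro k hk
    obtain ⟨hk, hkz⟩ := Finset.mem_filter.1 hk
    rw [Finset.mem_range] at hk
    obtain ⟨_, hkz'⟩ := List.getElem?_eq_some_iff.1 hkz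
    obtain ⟨m, rfl⟩ : ∃ m, k = m + 1 := Nat.exists_eq_succ_of_ne_zero (hhead k hk hkz')
    have h2 : m + 2 < γ.length := hlast (m + 1) hk hkz'
    show ((2 * Real.cos (σ * Real.pi / 4) : ℝ) : ℂ) * Complex.exp (-Complex.I * (σ : ℂ) *
        (((Polyline.winding ((γ.map (medialPoint δ)).take (m + 2)) +
          Polyline.winding ((γ.map (medialPoint δ)).take (m + 3))) / 2 : ℝ) : ℂ)) = e (m + 2) + e (m + 3)
    apply split_phase_spin
    rw [winding_take_succ (γ.map (medialPoint δ)) (by simpa using h2), add_sub_cancel_left]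
    obtain ⟨v₁, f₁, hc₁, hs₁, ht₁⟩ := hdart m (by omega)
    obtain ⟨v₂, f₂, hc₂, hs₂, ht₂⟩ := hdart (m + 1) h2
    simp only [List.getElem_map]
    rw [← hs₁, ← ht₂, ← ht₁]
    exact abs_turning_at_mv hδ hc₁ (ht₁.trans hkz') hc₂ (hs₂.trans hkz')
  rw [MedialPath.passageSum_eq, Finset.mul_sum, Finset.sum_congr rfl hsplit, Finset.sum_add_distrib]
  obtain ⟨⟨hoL, hoR⟩, ⟨hiL, hiR⟩, hneO, hneI⟩ := corners_at_mv x i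
  rw [sum_passages_in (γ := γ) (c := (x, x + classOffset (inL i)))
      (c' := (x + ex i, x + ex i + classOffset (inR i))) hiL hiR hneI
      (fun v f hvf h => by
        rcases corner_of_target_eq_mv hvf h with ⟨rfl, rfl⟩ | ⟨rfl, rfl⟩ <;> simp)
      hdart hhead (fun k => e (k + 1)),
    sum_passages_out (γ := γ) (c := (x, x + classOffset (outL i)))
      (c' := (x + ex i, x + ex i + classOffset (outR i))) hoL hoR hneO
      (fun v f hvf h => by
        rcases corner_of_source_eq_mv hvf h with ⟨rfl, rfl⟩ | ⟨rfl, rfl⟩ <;> simp)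
      hdart hlast (fun k => e (k + 2)), sum_classes_eq]
  rfl

/-- **FOUR-DART SPLIT for the exploration path, spin `σ`**: for every datum `E`, mesh `δ ≠ 0`, configuration `ω` and genuine
medial vertex `s(x, x + eᵢ)` which is not an `A`–`B` edge of `E`,
`2cos(σπ/4) · passageSum γ δ σ s(x,x+eᵢ) = Σ_q dartPhaseSum γ δ σ (class-q corner)`, `γ = medialExploration E ω`. [folklore] -/
theorem fourDart_split_medialExploration_spin (σ : ℝ) (E : DiscreteDobrushin) {δ : ℝ} (hδ : δ ≠ 0)
    (ω : BondConfig (Site 2)) (x : Site 2) (i : Fin 2) (hz : mv (x, i) ∉ E.zdABEdges) :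
    ((2 * Real.cos (σ * Real.pi / 4) : ℝ) : ℂ) * MedialPath.passageSum (medialExploration E ω) δ σ (mv (x, i)) =
      ∑ q : Fin 4, Parafermion.dartPhaseSum (medialExploration E ω) δ σ (pivotOf x i q, pivotOf x i q + classOffset q) := by
  rcases medialExploration_eq_nil_or E ω with h | h
  · simp [h]
  · refine fourDart_split_spin σ hδ x i (fun k hk => (h.step _ _ (infix_pair_getElem' _ k hk)).isMedialDart)
      (fun k hk hkz => ?_) (fun k hk hkz => ?_)
    · rintro rfl
      rw [← List.head_eq_getElem h.ne_nil] at hkz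
      exact hz (hkz ▸ h.head_mem)
    · by_contra hlt
      have hlast : (medialExploration E ω).getLast h.ne_nil = mv (x, i) := by
        rw [List.getLast_eq_getElem]; convert hkz using 2; omega
      exact hz (hlast ▸ h.getLast_mem)

/-! ## The vertex form of the alias at spin `−5/3` -/

/-- `2cos(5π/12) = 2 sin(π/12) > 0`: the split constant at the alias spin `−5/3` is non-zero. [folklore] -/
theorem two_cos_alias_pos : 0 < 2 * Real.cos (((-5 : ℝ) / 3) * Real.pi / 4) := by
  have h : Real.cos (((-5 : ℝ) / 3) * Real.pi / 4) = Real.cos (5 * Real.pi / 12) := by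
    rw [← Real.cos_neg]; congr 1; ring
  rw [h]
  have : 0 < Real.cos (5 * Real.pi / 12) := Real.cos_pos_of_mem_Ioo ⟨by linarith [Real.pi_pos], by linarith [Real.pi_pos]⟩
  linarith

/-- **The alias vertex observable as a corner sum, at one mesh**: for every datum `E`, mesh `δ > 0` and genuine medial vertex `p`
which is not an `A`–`B` edge, `2cos(5π/12) · ∫ passageSum γ_ω δ (−5/3) z_p = Σ_k bondDartObservable E δ (−5/3) (c_{p,k})`.
[folklore] -/
theorem aliasVertex_eq_sum (E : DiscreteDobrushin) {δ : ℝ} (hδ : 0 < δ) (p : Site 2 × Fin 2)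
    (hz : medialVertexOf p ∉ E.zdABEdges) :
    ((2 * Real.cos (((-5 : ℝ) / 3) * Real.pi / 4) : ℝ) : ℂ) *
        ∫ ω, MedialPath.passageSum (medialExploration E ω) δ (-5 / 3) (medialVertexOf p) ∂(bondPercolation (zdGraph 2) half) =
      ∑ k : Fin 4, bondDartObservable E δ (-5 / 3) (medialCornersAt p.1 p.2 k) := by
  obtain ⟨x, i⟩ := p
  have hmv : medialVertexOf (x, i) = mv (x, i) := rfl
  have key : ∀ ω, ((2 * Real.cos (((-5 : ℝ) / 3) * Real.pi / 4) : ℝ) : ℂ) *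
      MedialPath.passageSum (medialExploration E ω) δ (-5 / 3) (mv (x, i)) =
        ∑ k : Fin 4, Parafermion.dartPhaseSum (medialExploration E ω) δ (-5 / 3) (medialCornersAt x i k) := by
    intro ω
    have h := fourDart_split_medialExploration_spin ((-5 : ℝ) / 3) E hδ.ne' ω x i (hmv ▸ hz)
    rw [show ((-5 : ℝ) / 3) = (-5 / 3 : ℝ) by norm_num] at h
    rw [h, ← sum_classComp_pivotOf (fun c => Parafermion.dartPhaseSum (medialExploration E ω) δ (-5 / 3) c) x i]
    rfl
  rw [hmv, ← integral_const_mul]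
  simp only [key]
  rw [integral_finsetSum _ fun k _ => integrable_dartPhaseSum E δ (-5 / 3) _]
  simp only [Parafermion.bondDartObservable_def]

/-- **The alias vertex observable as a corner sum, eventually above a compact** (as `dictionary_eventually`: the two `A`–`B`
edges leave every compact eventually): along an admissible family, eventually in `δ`, at every genuine medial vertex above `K`,
`2cos(5π/12) · F^{(−5/3)}_δ(z_p) = Σ_k bondDartObservable (Λ δ) δ (−5/3) (c_{p,k})`. [folklore] -/
theorem aliasVertex_eq_sum_eventually (D : DobrushinDomain) (Λ : ℝ → DiscreteDobrushin) (hΛ : IsFamily D Λ)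
    (K : Set ℂ) (hK : IsCompact K) (hKD : K ⊆ D.carrier) :
    ∀ᶠ δ in 𝓝[>] (0:ℝ), ∀ p : Site 2 × Fin 2, medialPoint δ (medialVertexOf p) ∈ K →
      ((2 * Real.cos (((-5 : ℝ) / 3) * Real.pi / 4) : ℝ) : ℂ) *
          ∫ ω, MedialPath.passageSum (medialExploration (Λ δ) ω) δ (-5 / 3) (medialVertexOf p)
            ∂(bondPercolation (zdGraph 2) half) =
        ∑ k : Fin 4, bondDartObservable (Λ δ) δ (-5 / 3) (medialCornersAt p.1 p.2 k) := by
  obtain ⟨-, -, -, -, hAB, -⟩ := hΛ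
  obtain ⟨r, hr, hrK⟩ := hK.exists_cthickening_subset_open D.isOpen hKD
  have hev : ∀ᶠ δ in 𝓝[>] (0:ℝ), Metric.hausdorffEDist (medialPoint δ '' (Λ δ).zdABEdges)
      {D.pt 0, D.pt 1} < ENNReal.ofReal r :=
    hAB.eventually (gt_mem_nhds (ENNReal.ofReal_pos.2 hr))
  filter_upwards [hev, self_mem_nhdsWithin] with δ hδlt hδpos p hpK
  refine aliasVertex_eq_sum (Λ δ) hδpos p fun hz => ?_
  obtain ⟨y, hy, hdist⟩ :=
    Metric.exists_edist_lt_of_hausdorffEDist_lt (mem_image_of_mem _ hz) hδlt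
  have hyf : y ∈ frontier D.carrier := by
    rcases hy with rfl | rfl <;> exact D.pt_mem_frontier _
  have hyD : y ∈ D.carrier := hrK (Metric.mem_cthickening_of_dist_le _ _ _ _ hpK
    (by rw [dist_comm]; exact (edist_lt_ofReal.1 hdist).le))
  exact hyf.2 (interior_maximal Subset.rfl D.isOpen hyD)

/-- **Registered one-line form of `aliasVertex_eq_sum_eventually`**: eventually along an admissible family, above every compact,
`2cos(5π/12)` times the spin-`−5/3` vertex observable of the exploration path equals the corner sum of the spin-`−5/3` dart
observable (every-spin four-dart split). [folklore] -/
theorem stub_aliasVertexEqSumEventually : ∀ (D : DobrushinDomain) (Λ : ℝ → DiscreteDobrushin), IsFamily D Λ → ∀ (K : Set ℂ), IsCompact K → K ⊆ D.carrier → ∀ᶠ δ in 𝓝[>] (0:ℝ), ∀ p : Site 2 × Fin 2, medialPoint δ (medialVertexOf p) ∈ K → ((2 * Real.cos (((-5 : ℝ) / 3) * Real.pi / 4) : ℝ) : ℂ) * (∫ ω, MedialPath.passageSum (medialExploration (Λ δ) ω) δ (-5 / 3) (medialVertexOf p) ∂(bondPercolation (zdGraph 2) half)) = ∑ k : Fin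 4, bondDartObservable (Λ δ) δ (-5 / 3) (medialCornersAt p.1 p.2 k) :=
  fun D Λ hΛ K hK hKD => aliasVertex_eq_sum_eventually D Λ hΛ K hK hKD

end Summit.CriticalPhenomena.CardyFormulaZ2.Theorems.WeakHolomorphy.SplitBypass

end
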